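import Summits.QuantumFields.BalabanUV.Beta.WardLocusRecursiveLetters
import Summits.QuantumFields.BalabanUV.Beta.WilsonWardColourFree

/-!
# `BalabanUV.Beta.WardLocusWilsonEnd` — binder row D1, (L4) W-side of hW: THE hW END AT THE ONE TABLE `T_W := (8N²)⁻¹ • wsym22 N`, COLOUR-FREE —
# hW(v2.26-W) for the recursive W-literal, every `SU(N)` with `2 ≤ N`, NO colour hypothesis, FROM an1's BORDER AND MIXED LETTERS ONLY
# (β sub-cell, D1 formalisation swarm, unit `b2b-balaban-beta-d1-formalise-leaf-06`, gen 3; INTENT «D1-hW-END-TW-SU» journal 2026-08-20; referee #13 item 6)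

NOT IN PRINT; OUR BOOKKEEPING.  HONEST FRAMING (cell charter, verbatim): «discharging `BetaPertH` makes Bałaban's UV stability UNCONDITIONAL — a real
constructive-QFT result; it is NOT the continuum limit and NOT the Clay problem.»  HONEST DEPENDENCY (verbatim): «continuum YM on T⁴ ⇐ BetaPertH ∧ nine spine
estimates (0/9 proved); BetaPertH ⇐ (D1) ∧ (D4) ∧ CAP+tail; G-an2-4 gates asym, D1 and NE2/3/4.»  [folklore] composition BY NAME of two tree theorems:
`WardLocusRecursiveLetters.wardTransversal_flipK_TbalOf_JsRecWAtOf_of_letters` (hW ⟸ letters, leaf-06 g3) with its Wilson sockets `hWil`∕`hWil''` fed, remainder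
`RW = RW″ = 0`, by an3-g32's `WilsonWardColourFree.hWil_wilson_TW_su` ∕ `hWil''_wilson_TW_su` (filed by leaf-05-g6; over leaf-09-g4's `hS₂_wilson` and the
`SU(N)` basis `ColourBasisSU.suGen`) at the ONE table `T_W := (8N²)⁻¹ • wsym22 N` of the hR side (an2-g19 K-F `SpineRecursiveT2AllWilson`, referee I-d1ref12-1)
under the ONE pin `cE₂ = Lc^{2(d+1)}`; plus the colour-basis variant over `WilsonWardSocketFit.hWil_wilson_TW` ∕ `hWil''_wilson_TW`.  an1's border and mixed
letters, their remainder classes∕parities and the pin stay DISPLAYED HYPOTHESES; no statement of Bałaban's papers, no `[cite:]`, no `def`, no `def … : Prop`;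
instantiates NO binder of the β-function wall.  NOT hW closed, NOT D1, NOT `BetaPertH`, NOT continuum, NOT Clay.

* **`wardTransversal_flipK_TbalOf_JsRecWAtOf_TW_su`** (`d = 3`, `2 ≤ N`, NO colour hypothesis): `∀ j, WardTransversal (flipK (TbalOf Lc (JsRecWAtOf hLc hr Lc⁴
  (−Lc⁴·½·Lc⁴) cΛ cE₂ cB ((8N²)⁻¹ • wsym22 N) hB hmix) j))` ⟸ EXACTLY an1's BORDER letter (both slots, level 0 and every level j+1) + MIXED letter (every level) +
  remainder classes (one `(C, δ)` per level) + row parities + `hBt`∕`hmixt`.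
* `wardTransversal_flipK_TbalOf_JsRecWAtOf_TW` — the same for any trace-orthonormal complete colour basis `(τ, hτ, ho)`, `N ≠ 0`, an index `c`.
* `wardTransversal_flipK_TbalOf_JsRecWAtOf_TW_su_exact` — the same with EXACT border Ward letters (`RB = RB″ = 0`, the anti-twin form forced by the
  owner's parity split X-an2-47-K `SecondOrderLetterParity`): hypotheses = an1's exact border law (both slots, ∀ j ≥ 0) + mixed letter with `RM` + `hBt`∕`hmixt`.
Provenance: D1 formalisation swarm, leaf prover 06 (gen 3), 2026-08-20; no existing file touched.
-/

noncomputable section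

open Finset
open scoped BigOperators
open Literature.MathematicalPhysics.QuantumFieldTheory
open Literature.MathematicalPhysics.QuantumFieldTheory.Balaban1983to89
open Literature.MathematicalPhysics.QuantumFieldTheory.Balaban1983to89.Beta
open ExpKernelCalculus (MKer Decays BiLoc VertexFamily VertexFamily₂ comp shiftK)
open KernelWard (divV divW)
open AffineAveraging (Site box toSite)
open OneStepResolventKernel (Fib LocStencil)
open OneStepKernelFamily (KInvStep TbalOf flipK)
open PolarizationSign (WardTransversal)
open BalabanStepJetsSucc (wE wVH)
open SecondOrderResponse (LocStencilFM)
open BalabanCompositeJets (LocStencil₂)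
open BalabanStepW2 (M2Of wV4 wB2)
open StepJetData (wilsonA)
open WilsonBiStencil (wilsonW₂)
open WilsonVertex2Sym (wsym22)
open ColourTrace (Complete TrOrthonormal)
open AveragingHessianKernelsRooted (vhSAt)
open Summit.QuantumFields.BalabanUV.Beta.TameKernelCalculus
open Summit.QuantumFields.BalabanUV.Beta.BorderedHessian (diagK stepScale sgnK)
open Summit.QuantumFields.BalabanUV.Beta.AveragingWardRootedStencils (legInd)
open Summit.QuantumFields.BalabanUV.Beta.SpineRooted (M1At JsRecWAtOf)
open Summit.QuantumFields.BalabanUV.Beta.SpineRecursiveParity (parityOdd_zero)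
open Summit.QuantumFields.BalabanUV.Beta.WilsonWardSocketFit (hWil_wilson_TW hWil''_wilson_TW)
open Summit.QuantumFields.BalabanUV.Beta.WilsonWardColourFree (hWil_wilson_TW_su hWil''_wilson_TW_su)
open Summit.QuantumFields.BalabanUV.Beta.WardLocusRecursiveLetters (wardTransversal_flipK_TbalOf_JsRecWAtOf_of_letters)

namespace Summit.QuantumFields.BalabanUV.Beta.WardLocusWilsonEnd

variable {Lc N : ℕ} [NeZero Lc]

/-- [folklore] The zero remainder table is in every `LocStencil` class with a nonnegative constant. -/
theorem locStencil_zero_apply {C δ : ℝ} (hC : 0 ≤ C) (Y : Fin (3 + 1) → ℤ) :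
    LocStencil ((0 : (Fin (3 + 1) → ℤ) → Fin (3 + 1) → (Fin (3 + 1) → ℤ) → MKer (3 + 1) (Fib 3)) Y) C δ := fun κ u x z a b => by
  simp only [Pi.zero_apply, abs_zero]
  exact mul_nonneg hC (Real.exp_pos _).le

/-- [folklore] **hW(v2.26-W) FOR THE RECURSIVE W-LITERAL AT THE ONE TABLE `T_W := (8N²)⁻¹ • wsym22 N`, EVERY `SU(N)` (`2 ≤ N`), NO COLOUR HYPOTHESIS, FROM an1's
BORDER AND MIXED LETTERS ONLY** (`d = 3`, `Lc ≥ 1`, in-block root, pin `cE₂ = Lc^{2(3+1)}`): the border Ward letter (both slots, every level) and the mixed Ward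
letter (every level) with their remainders' classes (one rate per level) and row parities, + `hBt`∕`hmixt`, give
`∀ j, WardTransversal (flipK (TbalOf Lc (JsRecWAtOf hLc hr Lc⁴ (−Lc⁴·½·Lc⁴) cΛ cE₂ cB ((8N²)⁻¹ • wsym22 N) hB hmix) j))` —
`WardLocusRecursiveLetters.wardTransversal_flipK_TbalOf_JsRecWAtOf_of_letters` with `RW = RW″ = 0`, the Wilson sockets fed BY NAME by
`WilsonWardColourFree.hWil_wilson_TW_su` ∕ `hWil''_wilson_TW_su`, parities by `parityOdd_zero`. -/
theorem wardTransversal_flipK_TbalOf_JsRecWAtOf_TW_su (hN : 2 ≤ N)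
    (hLc : 1 ≤ Lc) {r : Fin (3 + 1) → ℕ} (hr : r ∈ box (3 + 1) Lc) (cΛ cB : ℝ) {cE₂ : ℝ}
    (hcE₂ : cE₂ = (Lc : ℝ) ^ (2 * (3 + 1)))
    {vh₂S : Fin (3 + 1) → (Fin (3 + 1) → ℤ) → Fin (3 + 1) → (Fin (3 + 1) → ℤ) → MKer (3 + 1) (Fib 3)}
    (hB : ∃ C δ : ℝ, 0 < δ ∧ LocStencil₂ vh₂S C δ)
    (hBt : ∀ (κ : Fin (3 + 1)) (u : Fin (3 + 1) → ℤ) (κ' : Fin (3 + 1)) (u' t : Fin (3 + 1) → ℤ),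
      vh₂S κ (u + (Lc : ℤ) • t) κ' (u' + (Lc : ℤ) • t) = shiftK (-((Lc : ℤ) • t)) (vh₂S κ u κ' u'))
    {mixFF : Fin (3 + 1) → (Fin (3 + 1) → ℤ) → Fin (3 + 1) → (Fin (3 + 1) → ℤ) → MKer (3 + 1) (Fib 3)}
    (hmix : ∃ C δ : ℝ, 0 < δ ∧ LocStencilFM Lc mixFF C δ)
    (hmixt : ∀ (κ : Fin (3 + 1)) (u : Fin (3 + 1) → ℤ) (μ : Fin (3 + 1)) (w t : Fin (3 + 1) → ℤ),
      mixFF κ (u + (Lc : ℤ) • t) μ (w + t) = shiftK (-((Lc : ℤ) • t)) (mixFF κ u μ w))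
    {RB RB'' : ℕ → (Fin (3 + 1) → ℤ) → Fin (3 + 1) → (Fin (3 + 1) → ℤ) → MKer (3 + 1) (Fib 3)} {RM : ℕ → (Fin (3 + 1) → ℤ) → Fin (3 + 1) → (Fin (3 + 1) → ℤ) → MKer (3 + 1) (Fib 3)}
    (hcls0 : ∃ C δ : ℝ, 0 < δ ∧ (∀ Y, LocStencil (RB 0 Y) C δ) ∧ (∀ Y, LocStencil (RB'' 0 Y) C δ) ∧ (∀ y, VertexFamily (RM 0 y) Lc C δ))
    (hclsS : ∀ j : ℕ, ∃ C δ : ℝ, 0 < δ ∧ (∀ Y, LocStencil (RB (j + 1) Y) C δ) ∧ (∀ Y, LocStencil (RB'' (j + 1) Y) C δ) ∧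
      (∀ y, VertexFamily (RM (j + 1) y) Lc C δ))
    (hRBp : ∀ j Y κ u, trK (RB j Y κ u) = -sgnK (RB j Y κ u)) (hRB''p : ∀ j Y κ u, trK (RB'' j Y κ u) = -sgnK (RB'' j Y κ u))
    (hRMp : ∀ j y ρ' w, trK (RM j y ρ' w) = -sgnK (RM j y ρ' w))
    (hBord0 : ∀ (Y : Fin (3 + 1) → ℤ) (κ' : Fin (3 + 1)) (u' : Fin (3 + 1) → ℤ),
      (stepScale 3 Lc 0 * (Lc : ℝ) ^ (3 + 1))⁻¹ • ∑ v ∈ box (3 + 1) Lc, divV (fun κ u => cB • vh₂S κ u κ' u') ((Lc : ℤ) • Y + toSite v) =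
        comp ((-((Lc : ℝ) ^ (3 + 1) * (1 / 2) * (Lc : ℝ) ^ (3 + 1))) • vhSAt (toSite r) 3 Lc rfl κ' u') (diagK (((1 : ℝ) / 2) • ∑ v ∈ box (3 + 1) Lc, legInd (toSite r) ((Lc : ℤ) • Y + toSite v)))
          - comp (diagK (((1 : ℝ) / 2) • ∑ v ∈ box (3 + 1) Lc, legInd (toSite r) ((Lc : ℤ) • Y + toSite v))) ((-((Lc : ℝ) ^ (3 + 1) * (1 / 2) * (Lc : ℝ) ^ (3 + 1))) • vhSAt (toSite r) 3 Lc rfl κ' u')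
          + RB 0 Y κ' u')
    (hBord0'' : ∀ (Y : Fin (3 + 1) → ℤ) (κ : Fin (3 + 1)) (u : Fin (3 + 1) → ℤ),
      (stepScale 3 Lc 0 * (Lc : ℝ) ^ (3 + 1))⁻¹ • ∑ v ∈ box (3 + 1) Lc, divV (fun κ' u' => cB • vh₂S κ u κ' u') ((Lc : ℤ) • Y + toSite v) =
        comp ((-((Lc : ℝ) ^ (3 + 1) * (1 / 2) * (Lc : ℝ) ^ (3 + 1))) • vhSAt (toSite r) 3 Lc rfl κ u) (diagK (((1 : ℝ) / 2) • ∑ v ∈ box (3 + 1) Lc, legInd (toSite r) ((Lc : ℤ) • Y + toSite v)))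
          - comp (diagK (((1 : ℝ) / 2) • ∑ v ∈ box (3 + 1) Lc, legInd (toSite r) ((Lc : ℤ) • Y + toSite v))) ((-((Lc : ℝ) ^ (3 + 1) * (1 / 2) * (Lc : ℝ) ^ (3 + 1))) • vhSAt (toSite r) 3 Lc rfl κ u)
          + RB'' 0 Y κ u)
    (hBordS : ∀ (j : ℕ) (Y : Fin (3 + 1) → ℤ) (κ' : Fin (3 + 1)) (u' : Fin (3 + 1) → ℤ),
      (stepScale 3 Lc (j + 1) * (Lc : ℝ) ^ (3 + 1))⁻¹ •
          ∑ v ∈ box (3 + 1) Lc, divV (fun κ u => (cB * wB2 3 Lc (j + 1)) • vh₂S κ u κ' u') ((Lc : ℤ) • Y + toSite v) =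
        comp ((-((Lc : ℝ) ^ (3 + 1) * (1 / 2) * (Lc : ℝ) ^ (3 + 1)) * wVH 3 Lc (j + 1)) • vhSAt (toSite r) 3 Lc rfl κ' u') (diagK (((1 : ℝ) / 2) • ∑ v ∈ box (3 + 1) Lc, legInd (toSite r) ((Lc : ℤ) • Y + toSite v)))
          - comp (diagK (((1 : ℝ) / 2) • ∑ v ∈ box (3 + 1) Lc, legInd (toSite r) ((Lc : ℤ) • Y + toSite v))) ((-((Lc : ℝ) ^ (3 + 1) * (1 / 2) * (Lc : ℝ) ^ (3 + 1)) * wVH 3 Lc (j + 1)) • vhSAt (toSite r) 3 Lc rfl κ' u')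
          + RB (j + 1) Y κ' u')
    (hBordS'' : ∀ (j : ℕ) (Y : Fin (3 + 1) → ℤ) (κ : Fin (3 + 1)) (u : Fin (3 + 1) → ℤ),
      (stepScale 3 Lc (j + 1) * (Lc : ℝ) ^ (3 + 1))⁻¹ •
          ∑ v ∈ box (3 + 1) Lc, divV (fun κ' u' => (cB * wB2 3 Lc (j + 1)) • vh₂S κ u κ' u') ((Lc : ℤ) • Y + toSite v) =
        comp ((-((Lc : ℝ) ^ (3 + 1) * (1 / 2) * (Lc : ℝ) ^ (3 + 1)) * wVH 3 Lc (j + 1)) • vhSAt (toSite r) 3 Lc rfl κ u) (diagK (((1 : ℝ) / 2) • ∑ v ∈ box (3 + 1) Lc, legInd (toSite r) ((Lc : ℤ) • Y + toSite v)))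
          - comp (diagK (((1 : ℝ) / 2) • ∑ v ∈ box (3 + 1) Lc, legInd (toSite r) ((Lc : ℤ) • Y + toSite v))) ((-((Lc : ℝ) ^ (3 + 1) * (1 / 2) * (Lc : ℝ) ^ (3 + 1)) * wVH 3 Lc (j + 1)) • vhSAt (toSite r) 3 Lc rfl κ u)
          + RB'' (j + 1) Y κ u)
    (hM₂ : ∀ (j : ℕ) (y : Fin (3 + 1) → ℤ) (ρ' : Fin (3 + 1)) (w : Fin (3 + 1) → ℤ),
      (stepScale 3 Lc j * (Lc : ℝ) ^ (3 + 1))⁻¹ • ∑ v ∈ box (3 + 1) Lc, divV (fun κ u => M2Of 3 Lc mixFF j κ u ρ' w) ((Lc : ℤ) • y + toSite v) =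
        comp (M1At 3 Lc (toSite r) cΛ j ρ' w) (diagK (((1 : ℝ) / 2) • ∑ v ∈ box (3 + 1) Lc, legInd (toSite r) ((Lc : ℤ) • y + toSite v)))
          - comp (diagK (((1 : ℝ) / 2) • ∑ v ∈ box (3 + 1) Lc, legInd (toSite r) ((Lc : ℤ) • y + toSite v))) (M1At 3 Lc (toSite r) cΛ j ρ' w)
          + RM j y ρ' w) :
    ∀ j : ℕ, WardTransversal (flipK (TbalOf Lc
      (JsRecWAtOf (d := 3) hLc hr ((Lc : ℝ) ^ (3 + 1)) (-((Lc : ℝ) ^ (3 + 1) * (1 / 2) * (Lc : ℝ) ^ (3 + 1))) cΛ cE₂ cB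
        ((8 * (N : ℝ) ^ 2)⁻¹ • wsym22 N) hB hmix) j)) := by
  obtain ⟨C0, δ0, hδ0, hRBl, hRB''l, hRMl⟩ := hcls0
  have hC0 : 0 ≤ C0 := (hRMl 0 0 0).nonneg (Sum.inl 0)
  exact wardTransversal_flipK_TbalOf_JsRecWAtOf_of_letters hLc hr cΛ cB hcE₂ ((8 * (N : ℝ) ^ 2)⁻¹ • wsym22 N) hB hmix
    (RW := 0) (RW'' := 0)
    ⟨C0, δ0, hδ0, locStencil_zero_apply hC0, locStencil_zero_apply hC0, hRBl, hRB''l, hRMl⟩ hclsS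
    (fun Y κ u => parityOdd_zero) (fun Y κ u => parityOdd_zero) hRBp hRB''p hRMp
    (hWil_wilson_TW_su (d := 3) hN Lc r hcE₂) (hWil''_wilson_TW_su (d := 3) hN Lc r hcE₂) hBord0 hBord0'' hBordS hBordS'' hM₂ hBt hmixt

/-- [folklore] **THE SAME FOR ANY TRACE-ORTHONORMAL COMPLETE COLOUR BASIS** `τ : C → 𝔲(N)` (`Complete τ`, `TrOrthonormal τ`, `N ≠ 0`, an index `c`) — the Wilson
sockets fed by `WilsonWardSocketFit.hWil_wilson_TW` ∕ `hWil''_wilson_TW`. -/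
theorem wardTransversal_flipK_TbalOf_JsRecWAtOf_TW {C : Type*} [Fintype C] [DecidableEq C] {τ : C → Matrix (Fin N) (Fin N) ℂ}
    (hτ : Complete τ) (ho : TrOrthonormal τ) (hN : N ≠ 0) (c : C)
    (hLc : 1 ≤ Lc) {r : Fin (3 + 1) → ℕ} (hr : r ∈ box (3 + 1) Lc) (cΛ cB : ℝ) {cE₂ : ℝ}
    (hcE₂ : cE₂ = (Lc : ℝ) ^ (2 * (3 + 1)))
    {vh₂S : Fin (3 + 1) → (Fin (3 + 1) → ℤ) → Fin (3 + 1) → (Fin (3 + 1) → ℤ) → MKer (3 + 1) (Fib 3)}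
    (hB : ∃ C δ : ℝ, 0 < δ ∧ LocStencil₂ vh₂S C δ)
    (hBt : ∀ (κ : Fin (3 + 1)) (u : Fin (3 + 1) → ℤ) (κ' : Fin (3 + 1)) (u' t : Fin (3 + 1) → ℤ),
      vh₂S κ (u + (Lc : ℤ) • t) κ' (u' + (Lc : ℤ) • t) = shiftK (-((Lc : ℤ) • t)) (vh₂S κ u κ' u'))
    {mixFF : Fin (3 + 1) → (Fin (3 + 1) → ℤ) → Fin (3 + 1) → (Fin (3 + 1) → ℤ) → MKer (3 + 1) (Fib 3)}
    (hmix : ∃ C δ : ℝ, 0 < δ ∧ LocStencilFM Lc mixFF C δ)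
    (hmixt : ∀ (κ : Fin (3 + 1)) (u : Fin (3 + 1) → ℤ) (μ : Fin (3 + 1)) (w t : Fin (3 + 1) → ℤ),
      mixFF κ (u + (Lc : ℤ) • t) μ (w + t) = shiftK (-((Lc : ℤ) • t)) (mixFF κ u μ w))
    {RB RB'' : ℕ → (Fin (3 + 1) → ℤ) → Fin (3 + 1) → (Fin (3 + 1) → ℤ) → MKer (3 + 1) (Fib 3)} {RM : ℕ → (Fin (3 + 1) → ℤ) → Fin (3 + 1) → (Fin (3 + 1) → ℤ) → MKer (3 + 1) (Fib 3)}
    (hcls0 : ∃ C δ : ℝ, 0 < δ ∧ (∀ Y, LocStencil (RB 0 Y) C δ) ∧ (∀ Y, LocStencil (RB'' 0 Y) C δ) ∧ (∀ y, VertexFamily (RM 0 y) Lc C δ))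
    (hclsS : ∀ j : ℕ, ∃ C δ : ℝ, 0 < δ ∧ (∀ Y, LocStencil (RB (j + 1) Y) C δ) ∧ (∀ Y, LocStencil (RB'' (j + 1) Y) C δ) ∧
      (∀ y, VertexFamily (RM (j + 1) y) Lc C δ))
    (hRBp : ∀ j Y κ u, trK (RB j Y κ u) = -sgnK (RB j Y κ u)) (hRB''p : ∀ j Y κ u, trK (RB'' j Y κ u) = -sgnK (RB'' j Y κ u))
    (hRMp : ∀ j y ρ' w, trK (RM j y ρ' w) = -sgnK (RM j y ρ' w))
    (hBord0 : ∀ (Y : Fin (3 + 1) → ℤ) (κ' : Fin (3 + 1)) (u' : Fin (3 + 1) → ℤ),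
      (stepScale 3 Lc 0 * (Lc : ℝ) ^ (3 + 1))⁻¹ • ∑ v ∈ box (3 + 1) Lc, divV (fun κ u => cB • vh₂S κ u κ' u') ((Lc : ℤ) • Y + toSite v) =
        comp ((-((Lc : ℝ) ^ (3 + 1) * (1 / 2) * (Lc : ℝ) ^ (3 + 1))) • vhSAt (toSite r) 3 Lc rfl κ' u') (diagK (((1 : ℝ) / 2) • ∑ v ∈ box (3 + 1) Lc, legInd (toSite r) ((Lc : ℤ) • Y + toSite v)))
          - comp (diagK (((1 : ℝ) / 2) • ∑ v ∈ box (3 + 1) Lc, legInd (toSite r) ((Lc : ℤ) • Y + toSite v))) ((-((Lc : ℝ) ^ (3 + 1) * (1 / 2) * (Lc : ℝ) ^ (3 + 1))) • vhSAt (toSite r) 3 Lc rfl κ' u')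
          + RB 0 Y κ' u')
    (hBord0'' : ∀ (Y : Fin (3 + 1) → ℤ) (κ : Fin (3 + 1)) (u : Fin (3 + 1) → ℤ),
      (stepScale 3 Lc 0 * (Lc : ℝ) ^ (3 + 1))⁻¹ • ∑ v ∈ box (3 + 1) Lc, divV (fun κ' u' => cB • vh₂S κ u κ' u') ((Lc : ℤ) • Y + toSite v) =
        comp ((-((Lc : ℝ) ^ (3 + 1) * (1 / 2) * (Lc : ℝ) ^ (3 + 1))) • vhSAt (toSite r) 3 Lc rfl κ u) (diagK (((1 : ℝ) / 2) • ∑ v ∈ box (3 + 1) Lc, legInd (toSite r) ((Lc : ℤ) • Y + toSite v)))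
          - comp (diagK (((1 : ℝ) / 2) • ∑ v ∈ box (3 + 1) Lc, legInd (toSite r) ((Lc : ℤ) • Y + toSite v))) ((-((Lc : ℝ) ^ (3 + 1) * (1 / 2) * (Lc : ℝ) ^ (3 + 1))) • vhSAt (toSite r) 3 Lc rfl κ u)
          + RB'' 0 Y κ u)
    (hBordS : ∀ (j : ℕ) (Y : Fin (3 + 1) → ℤ) (κ' : Fin (3 + 1)) (u' : Fin (3 + 1) → ℤ),
      (stepScale 3 Lc (j + 1) * (Lc : ℝ) ^ (3 + 1))⁻¹ •
          ∑ v ∈ box (3 + 1) Lc, divV (fun κ u => (cB * wB2 3 Lc (j + 1)) • vh₂S κ u κ' u') ((Lc : ℤ) • Y + toSite v) =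
        comp ((-((Lc : ℝ) ^ (3 + 1) * (1 / 2) * (Lc : ℝ) ^ (3 + 1)) * wVH 3 Lc (j + 1)) • vhSAt (toSite r) 3 Lc rfl κ' u') (diagK (((1 : ℝ) / 2) • ∑ v ∈ box (3 + 1) Lc, legInd (toSite r) ((Lc : ℤ) • Y + toSite v)))
          - comp (diagK (((1 : ℝ) / 2) • ∑ v ∈ box (3 + 1) Lc, legInd (toSite r) ((Lc : ℤ) • Y + toSite v))) ((-((Lc : ℝ) ^ (3 + 1) * (1 / 2) * (Lc : ℝ) ^ (3 + 1)) * wVH 3 Lc (j + 1)) • vhSAt (toSite r) 3 Lc rfl κ' u')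
          + RB (j + 1) Y κ' u')
    (hBordS'' : ∀ (j : ℕ) (Y : Fin (3 + 1) → ℤ) (κ : Fin (3 + 1)) (u : Fin (3 + 1) → ℤ),
      (stepScale 3 Lc (j + 1) * (Lc : ℝ) ^ (3 + 1))⁻¹ •
          ∑ v ∈ box (3 + 1) Lc, divV (fun κ' u' => (cB * wB2 3 Lc (j + 1)) • vh₂S κ u κ' u') ((Lc : ℤ) • Y + toSite v) =
        comp ((-((Lc : ℝ) ^ (3 + 1) * (1 / 2) * (Lc : ℝ) ^ (3 + 1)) * wVH 3 Lc (j + 1)) • vhSAt (toSite r) 3 Lc rfl κ u) (diagK (((1 : ℝ) / 2) • ∑ v ∈ box (3 + 1) Lc, legInd (toSite r) ((Lc : ℤ) • Y + toSite v)))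
          - comp (diagK (((1 : ℝ) / 2) • ∑ v ∈ box (3 + 1) Lc, legInd (toSite r) ((Lc : ℤ) • Y + toSite v))) ((-((Lc : ℝ) ^ (3 + 1) * (1 / 2) * (Lc : ℝ) ^ (3 + 1)) * wVH 3 Lc (j + 1)) • vhSAt (toSite r) 3 Lc rfl κ u)
          + RB'' (j + 1) Y κ u)
    (hM₂ : ∀ (j : ℕ) (y : Fin (3 + 1) → ℤ) (ρ' : Fin (3 + 1)) (w : Fin (3 + 1) → ℤ),
      (stepScale 3 Lc j * (Lc : ℝ) ^ (3 + 1))⁻¹ • ∑ v ∈ box (3 + 1) Lc, divV (fun κ u => M2Of 3 Lc mixFF j κ u ρ' w) ((Lc : ℤ) • y + toSite v) =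
        comp (M1At 3 Lc (toSite r) cΛ j ρ' w) (diagK (((1 : ℝ) / 2) • ∑ v ∈ box (3 + 1) Lc, legInd (toSite r) ((Lc : ℤ) • y + toSite v)))
          - comp (diagK (((1 : ℝ) / 2) • ∑ v ∈ box (3 + 1) Lc, legInd (toSite r) ((Lc : ℤ) • y + toSite v))) (M1At 3 Lc (toSite r) cΛ j ρ' w)
          + RM j y ρ' w) :
    ∀ j : ℕ, WardTransversal (flipK (TbalOf Lc
      (JsRecWAtOf (d := 3) hLc hr ((Lc : ℝ) ^ (3 + 1)) (-((Lc : ℝ) ^ (3 + 1) * (1 / 2) * (Lc : ℝ) ^ (3 + 1))) cΛ cE₂ cB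
        ((8 * (N : ℝ) ^ 2)⁻¹ • wsym22 N) hB hmix) j)) := by
  obtain ⟨C0, δ0, hδ0, hRBl, hRB''l, hRMl⟩ := hcls0
  have hC0 : 0 ≤ C0 := (hRMl 0 0 0).nonneg (Sum.inl 0)
  exact wardTransversal_flipK_TbalOf_JsRecWAtOf_of_letters hLc hr cΛ cB hcE₂ ((8 * (N : ℝ) ^ 2)⁻¹ • wsym22 N) hB hmix
    (RW := 0) (RW'' := 0)
    ⟨C0, δ0, hδ0, locStencil_zero_apply hC0, locStencil_zero_apply hC0, hRBl, hRB''l, hRMl⟩ hclsS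
    (fun Y κ u => parityOdd_zero) (fun Y κ u => parityOdd_zero) hRBp hRB''p hRMp
    (hWil_wilson_TW hτ ho hN c Lc r hcE₂) (hWil''_wilson_TW hτ ho hN c Lc r hcE₂) hBord0 hBord0'' hBordS hBordS'' hM₂ hBt hmixt

/-- [folklore] **THE SAME WITH EXACT BORDER WARD LETTERS** (no border residual: `RB = RB″ = 0`) — the form the border letter must take for an ANTI-TWIN
bordered table (owner NOTE X-an2-47-K, `SecondOrderLetterParity.odd_eq_zero_of_even_letter`: an even letter with an odd residual is exact; a TWIN table
admits no model of the residual form, `even_eq_zero_of_odd_letter`): hW(v2.26-W) at `T_W`, every `SU(N)` (`2 ≤ N`), NO colour hypothesis ⟸ EXACTLY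
an1's EXACT border Ward law (both slots, level 0 and every level j+1) + the mixed Ward letter with its residual `RM` (one `VertexFamily` rate per level,
row-parity-odd) + `hBt`∕`hmixt`. -/
theorem wardTransversal_flipK_TbalOf_JsRecWAtOf_TW_su_exact (hN : 2 ≤ N)
    (hLc : 1 ≤ Lc) {r : Fin (3 + 1) → ℕ} (hr : r ∈ box (3 + 1) Lc) (cΛ cB : ℝ) {cE₂ : ℝ}
    (hcE₂ : cE₂ = (Lc : ℝ) ^ (2 * (3 + 1)))
    {vh₂S : Fin (3 + 1) → (Fin (3 + 1) → ℤ) → Fin (3 + 1) → (Fin (3 + 1) → ℤ) → MKer (3 + 1) (Fib 3)}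
    (hB : ∃ C δ : ℝ, 0 < δ ∧ LocStencil₂ vh₂S C δ)
    (hBt : ∀ (κ : Fin (3 + 1)) (u : Fin (3 + 1) → ℤ) (κ' : Fin (3 + 1)) (u' t : Fin (3 + 1) → ℤ),
      vh₂S κ (u + (Lc : ℤ) • t) κ' (u' + (Lc : ℤ) • t) = shiftK (-((Lc : ℤ) • t)) (vh₂S κ u κ' u'))
    {mixFF : Fin (3 + 1) → (Fin (3 + 1) → ℤ) → Fin (3 + 1) → (Fin (3 + 1) → ℤ) → MKer (3 + 1) (Fib 3)}
    (hmix : ∃ C δ : ℝ, 0 < δ ∧ LocStencilFM Lc mixFF C δ)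
    (hmixt : ∀ (κ : Fin (3 + 1)) (u : Fin (3 + 1) → ℤ) (μ : Fin (3 + 1)) (w t : Fin (3 + 1) → ℤ),
      mixFF κ (u + (Lc : ℤ) • t) μ (w + t) = shiftK (-((Lc : ℤ) • t)) (mixFF κ u μ w))
    {RM : ℕ → (Fin (3 + 1) → ℤ) → Fin (3 + 1) → (Fin (3 + 1) → ℤ) → MKer (3 + 1) (Fib 3)}
    (hclsM : ∀ j : ℕ, ∃ C δ : ℝ, 0 < δ ∧ ∀ y, VertexFamily (RM j y) Lc C δ)
    (hRMp : ∀ j y ρ' w, trK (RM j y ρ' w) = -sgnK (RM j y ρ' w))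
    (hBord0 : ∀ (Y : Fin (3 + 1) → ℤ) (κ' : Fin (3 + 1)) (u' : Fin (3 + 1) → ℤ),
      (stepScale 3 Lc 0 * (Lc : ℝ) ^ (3 + 1))⁻¹ • ∑ v ∈ box (3 + 1) Lc, divV (fun κ u => cB • vh₂S κ u κ' u') ((Lc : ℤ) • Y + toSite v) =
        comp ((-((Lc : ℝ) ^ (3 + 1) * (1 / 2) * (Lc : ℝ) ^ (3 + 1))) • vhSAt (toSite r) 3 Lc rfl κ' u') (diagK (((1 : ℝ) / 2) • ∑ v ∈ box (3 + 1) Lc, legInd (toSite r) ((Lc : ℤ) • Y + toSite v)))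
          - comp (diagK (((1 : ℝ) / 2) • ∑ v ∈ box (3 + 1) Lc, legInd (toSite r) ((Lc : ℤ) • Y + toSite v))) ((-((Lc : ℝ) ^ (3 + 1) * (1 / 2) * (Lc : ℝ) ^ (3 + 1))) • vhSAt (toSite r) 3 Lc rfl κ' u'))
    (hBord0'' : ∀ (Y : Fin (3 + 1) → ℤ) (κ : Fin (3 + 1)) (u : Fin (3 + 1) → ℤ),
      (stepScale 3 Lc 0 * (Lc : ℝ) ^ (3 + 1))⁻¹ • ∑ v ∈ box (3 + 1) Lc, divV (fun κ' u' => cB • vh₂S κ u κ' u') ((Lc : ℤ) • Y + toSite v) =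
        comp ((-((Lc : ℝ) ^ (3 + 1) * (1 / 2) * (Lc : ℝ) ^ (3 + 1))) • vhSAt (toSite r) 3 Lc rfl κ u) (diagK (((1 : ℝ) / 2) • ∑ v ∈ box (3 + 1) Lc, legInd (toSite r) ((Lc : ℤ) • Y + toSite v)))
          - comp (diagK (((1 : ℝ) / 2) • ∑ v ∈ box (3 + 1) Lc, legInd (toSite r) ((Lc : ℤ) • Y + toSite v))) ((-((Lc : ℝ) ^ (3 + 1) * (1 / 2) * (Lc : ℝ) ^ (3 + 1))) • vhSAt (toSite r) 3 Lc rfl κ u))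
    (hBordS : ∀ (j : ℕ) (Y : Fin (3 + 1) → ℤ) (κ' : Fin (3 + 1)) (u' : Fin (3 + 1) → ℤ),
      (stepScale 3 Lc (j + 1) * (Lc : ℝ) ^ (3 + 1))⁻¹ •
          ∑ v ∈ box (3 + 1) Lc, divV (fun κ u => (cB * wB2 3 Lc (j + 1)) • vh₂S κ u κ' u') ((Lc : ℤ) • Y + toSite v) =
        comp ((-((Lc : ℝ) ^ (3 + 1) * (1 / 2) * (Lc : ℝ) ^ (3 + 1)) * wVH 3 Lc (j + 1)) • vhSAt (toSite r) 3 Lc rfl κ' u') (diagK (((1 : ℝ) / 2) • ∑ v ∈ box (3 + 1) Lc, legInd (toSite r) ((Lc : ℤ) • Y + toSite v)))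
          - comp (diagK (((1 : ℝ) / 2) • ∑ v ∈ box (3 + 1) Lc, legInd (toSite r) ((Lc : ℤ) • Y + toSite v))) ((-((Lc : ℝ) ^ (3 + 1) * (1 / 2) * (Lc : ℝ) ^ (3 + 1)) * wVH 3 Lc (j + 1)) • vhSAt (toSite r) 3 Lc rfl κ' u'))
    (hBordS'' : ∀ (j : ℕ) (Y : Fin (3 + 1) → ℤ) (κ : Fin (3 + 1)) (u : Fin (3 + 1) → ℤ),
      (stepScale 3 Lc (j + 1) * (Lc : ℝ) ^ (3 + 1))⁻¹ •
          ∑ v ∈ box (3 + 1) Lc, divV (fun κ' u' => (cB * wB2 3 Lc (j + 1)) • vh₂S κ u κ' u') ((Lc : ℤ) • Y + toSite v) =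
        comp ((-((Lc : ℝ) ^ (3 + 1) * (1 / 2) * (Lc : ℝ) ^ (3 + 1)) * wVH 3 Lc (j + 1)) • vhSAt (toSite r) 3 Lc rfl κ u) (diagK (((1 : ℝ) / 2) • ∑ v ∈ box (3 + 1) Lc, legInd (toSite r) ((Lc : ℤ) • Y + toSite v)))
          - comp (diagK (((1 : ℝ) / 2) • ∑ v ∈ box (3 + 1) Lc, legInd (toSite r) ((Lc : ℤ) • Y + toSite v))) ((-((Lc : ℝ) ^ (3 + 1) * (1 / 2) * (Lc : ℝ) ^ (3 + 1)) * wVH 3 Lc (j + 1)) • vhSAt (toSite r) 3 Lc rfl κ u))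
    (hM₂ : ∀ (j : ℕ) (y : Fin (3 + 1) → ℤ) (ρ' : Fin (3 + 1)) (w : Fin (3 + 1) → ℤ),
      (stepScale 3 Lc j * (Lc : ℝ) ^ (3 + 1))⁻¹ • ∑ v ∈ box (3 + 1) Lc, divV (fun κ u => M2Of 3 Lc mixFF j κ u ρ' w) ((Lc : ℤ) • y + toSite v) =
        comp (M1At 3 Lc (toSite r) cΛ j ρ' w) (diagK (((1 : ℝ) / 2) • ∑ v ∈ box (3 + 1) Lc, legInd (toSite r) ((Lc : ℤ) • y + toSite v)))
          - comp (diagK (((1 : ℝ) / 2) • ∑ v ∈ box (3 + 1) Lc, legInd (toSite r) ((Lc : ℤ) • y + toSite v))) (M1At 3 Lc (toSite r) cΛ j ρ' w)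
          + RM j y ρ' w) :
    ∀ j : ℕ, WardTransversal (flipK (TbalOf Lc
      (JsRecWAtOf (d := 3) hLc hr ((Lc : ℝ) ^ (3 + 1)) (-((Lc : ℝ) ^ (3 + 1) * (1 / 2) * (Lc : ℝ) ^ (3 + 1))) cΛ cE₂ cB
        ((8 * (N : ℝ) ^ 2)⁻¹ • wsym22 N) hB hmix) j)) := by
  have hcls : ∀ j : ℕ, ∃ C δ : ℝ, 0 < δ ∧
      (∀ Y, LocStencil ((fun (_ : ℕ) (_ : Fin (3 + 1) → ℤ) (_ : Fin (3 + 1)) (_ : Fin (3 + 1) → ℤ) => (0 : MKer (3 + 1) (Fib 3))) j Y) C δ) ∧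
      (∀ Y, LocStencil ((fun (_ : ℕ) (_ : Fin (3 + 1) → ℤ) (_ : Fin (3 + 1)) (_ : Fin (3 + 1) → ℤ) => (0 : MKer (3 + 1) (Fib 3))) j Y) C δ) ∧
      (∀ y, VertexFamily (RM j y) Lc C δ) := by
    intro j
    obtain ⟨C, δ, hδ, hRM⟩ := hclsM j
    have hC : 0 ≤ C := (hRM 0 0 0).nonneg (Sum.inl 0)
    exact ⟨C, δ, hδ, locStencil_zero_apply hC, locStencil_zero_apply hC, hRM⟩
  exact wardTransversal_flipK_TbalOf_JsRecWAtOf_TW_su hN hLc hr cΛ cB hcE₂ hB hBt hmix hmixt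
    (RB := fun _ _ _ _ => 0) (RB'' := fun _ _ _ _ => 0) (hcls 0) (fun j => hcls (j + 1))
    (fun _ _ _ _ => parityOdd_zero) (fun _ _ _ _ => parityOdd_zero) hRMp
    (fun Y κ' u' => (hBord0 Y κ' u').trans (add_zero _).symm) (fun Y κ u => (hBord0'' Y κ u).trans (add_zero _).symm)
    (fun j Y κ' u' => (hBordS j Y κ' u').trans (add_zero _).symm) (fun j Y κ u => (hBordS'' j Y κ u).trans (add_zero _).symm) hM₂

end Summit.QuantumFields.BalabanUV.Beta.WardLocusWilsonEnd

end
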